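import Literature.NumberTheory.Automorphic.UnitaryGroupPureTensorEulerProduct
import Literature.NumberTheory.Automorphic.LocalUnitaryGroupCongrMeasure
import HarnessLib

/-!
# Haar measure on `U(H)(𝔸_{L⁺})` from NORMALISED local Haar measures: `dh = dh_∞ ⊗ ∏'_v dh_v`, `vol U(H)(𝒪_v) = 1`,
# with the Weil constant absorbed at infinity

Topic `NumberTheory/Automorphic`; namespace `Literature.NumberTheory.Automorphic.UnitaryGroup`.  THEOREMS ONLY (no definition, no
instance, no named fact, no `sorry`).  Sequel of ★ `LocalUnitaryGroupCongrMeasure` (the normalised local Haar measures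
`vol U(H)(𝒪_v) = 1` exist and are unique: `exists_isHaarMeasure_cmLocalIntegralLevel_eq_one`, `isHaarMeasure_eq_of_cmLocalIntegralLevel_eq_one`),
of ★ `UnitaryGroupPureTensorEulerProduct` (where the identification «Haar on `U(H)(𝔸_f)` = `κ_f` · restricted product of the local Haar
measures» is used INLINE) and of ★ `UnitaryGroupAdelicProductHaar` (`(adelicProdEquiv)_* dh = κ · dh_∞ ⊗ dh_f`), over the tree's generic
restricted-product Haar measure ★ `Literature.MeasureTheory.RestrictedProduct.rpMeasure` (`isHaarMeasure_rpMeasure`, Tate's `dα = ∏ dα_𝔭`,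
[CasselsFrohlichANT1967, Ch. XV §3.3]).  What this file NAMES, for the unitary group `U(H)` of a matrix `H ∈ M_N(L)` over a CM field `L`
(`UnitaryGroup.cmDatum L N H`):

* §1 `exists_isHaarMeasure_family_cmLocalIntegralLevel_eq_one` — a FAMILY `(ν_v)_v` of Haar measures on the `U(H)(L⁺_v)` with
  `ν_v(U(H)(𝒪_v)) = 1` for every finite `v`; `isHaarMeasure_map_localPiEquiv_symm`, `map_localPiEquiv_symm_apply_localInt` — read on the
  restricted-product model factors `localPi … v` through ★ `localPiEquiv`, the transported measures are Haar and still give mass `1` to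
  `localInt … v`;
* §2 `isHaarMeasure_rpMeasure_localInt` — the restricted product `∏'_v (ν_v ; U(H)(𝒪_v))` of such a family IS a Haar measure on
  `∏'_v (U(H)(L⁺_v) : U(H)(𝒪_v))`; `isHaarMeasure_map_finAdelicEquiv_symm` — transported to `U(H)(𝔸_{L⁺,f})` along ★ `finAdelicEquiv` it is a
  Haar measure `ν_f`; `map_finAdelicEquiv_symm_rpMeasure_apply_finAdelicIntegralLevel` — `ν_f(K_f⁰) = ∏_{v ∈ S₀} ν_v(U(H)(𝒪_v))` (`= 1` for the
  fully normalised family, `…_eq_one`); **`exists_eq_smul_map_finAdelicEquiv_symm_rpMeasure`** — EVERY Haar measure `μ_f` on `U(H)(𝔸_{L⁺,f})` is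
  `κ • ν_f` with `0 < κ < ∞` (Haar uniqueness; the step used inline by ★ `exists_integral_finFactor_eq_mul_prod`);
* §3 **`exists_isHaarMeasure_arch_eq_map_prod`** — for EVERY Haar measure `ν_𝔸` on `U(H)(𝔸_{L⁺}) = (cmDatum L N H).Adelic` and every Haar
  measure `ν_f` on `U(H)(𝔸_{L⁺,f})` there is a Haar measure `ν_∞` on `U(H)(L⁺ ⊗ ℝ)` with `ν_𝔸 = (adelicProdEquiv⁻¹)_* (ν_∞ ⊗ ν_f)` ON THE NOSE
  (the constant `κ` of ★ `exists_map_adelicProdEquiv_eq_smul_prod` is absorbed into `ν_∞`); with §2: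
  **`exists_isHaarMeasure_arch_eq_map_prod_rpMeasure`** — `ν_𝔸 = (adelicProdEquiv⁻¹)_* (ν_∞ ⊗ (finAdelicEquiv⁻¹)_* ∏'_v (ν_v ; U(H)(𝒪_v)))` for
  the given normalised local family.  These are exactly the «measures as EXPRESSIONS» hypotheses `hνrp`, `hνf`, `hνA` (with their
  `IsHaarMeasure` instance binders) of ★ `UnitaryGroup.finAdelicOrbitalMeasureOfLocal_quotientMeasure_eq` ∕ `adelicOrbitalMeasureOfLocal_quotientMeasure_eq`
  (`UnitaryGroup[Adelic]OrbitalMeasureOfLocalQuotient`), DISCHARGED for an arbitrary Haar measure `ν_𝔸` of the kit ([Rogawski1990, §4.3 p. 44,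
  §5.4 p. 72]: `dg = ⊗_v dg_v` with `vol(K_v) = 1` for almost all `v`).

Written for the cell `pub/hodgecm-mathlib`, ENGINE T1 line `F0_T1InnerFormTraceIdentity` (row (N-Haar ∕ C-glob), GO #90 (3)).  HC_CM is proved only
modulo the printed citations until rung 0 closes; this file is unconditional.

## Mathlib ∕ tree search
Tree: ★ `UnitaryGroup.exists_isHaarMeasure_cmLocalIntegralLevel_eq_one`, `isHaarMeasure_eq_of_cmLocalIntegralLevel_eq_one` (`LocalUnitaryGroupCongrMeasure`);
★ `finAdelicEquiv`, `finAdelicIntegralLevel`, `mem_finAdelicIntegralLevel_iff_forall`, `isOpen∕isCompact_finAdelicIntegralLevel` (`UnitaryGroupRestrictedProduct`);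
★ `localPiEquiv`, `localPiEquiv_symm_mem_localInt_iff`, `isOpen_localInt`, `isCompact_localInt`, `secondCountableTopology_localPi`, `locallyCompactSpace_localPi`;
★ `RestrictedProduct.rpMeasure`, `isHaarMeasure_rpMeasure`, `rpMeasure_haarBox`, `borelSpace`, `secondCountableTopology` (`MeasureTheory/RestrictedProduct/Haar`, `Borel`);
★ `Literature.MeasureTheory.Group.exists_map_continuousMulEquiv_eq_smul_prod`, `locallyCompactSpace_finAdelic`, `secondCountableTopology_finAdelic`
(`UnitaryGroupAdelicProductHaar`).  Mathlib: `ContinuousMulEquiv.isHaarMeasure_map`, `Measure.haarMeasure_unique`, `Measure.prod_smul_left`,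
`MeasurableEquiv.map_symm_map`, `IsHaarMeasure.smul`.

## References
* J. D. Rogawski, *Automorphic Representations of Unitary Groups in Three Variables*, Ann. of Math. Stud. 123 (1990), §4.3 p. 44, §5.4 p. 72 [Rogawski1990].
* J. W. S. Cassels, A. Fröhlich (eds.), *Algebraic Number Theory* (1967), Ch. XV (J. Tate, *Fourier analysis in number fields and Hecke's
  zeta-functions*), §3.3 [CasselsFrohlichANT1967].
* A. Borel, H. Jacquet, *Automorphic forms and automorphic representations*, Proc. Sympos. Pure Math. 33.1 (1979), §4.1 [BorelJacquet1979].
* V. Platonov, A. Rapinchuk, *Algebraic Groups and Number Theory* (1994), §3.5, §5.1 [PlatonovRapinchuk1994].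
-/

set_option autoImplicit false

noncomputable section

open _root_.MeasureTheory _root_.MeasureTheory.Measure Set Filter Function NumberField IsDedekindDomain
open _root_.Topology
open Literature.MeasureTheory.RestrictedProduct
open scoped RestrictedProduct ENNReal NNReal

namespace Literature.NumberTheory.Automorphic

namespace UnitaryGroup

variable (L : Type) [Field L] [NumberField L] [IsCMField L] (N : ℕ) (H : Matrix (Fin N) (Fin N) L)

/-! ## §1 The normalised local Haar measures, as a family, and on the model factors `localPi … v` -/

section Local

/-- **A normalised family of local Haar measures**: for every finite place `v` of `L⁺` a Haar measure `ν_v` on `U(H)(L⁺_v)` with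
`ν_v(U(H)(𝒪_v)) = 1` (★ `exists_isHaarMeasure_cmLocalIntegralLevel_eq_one`, place by place). [cite: PlatonovRapinchuk1994, §3.5] [cite: Rogawski1990, §5.4 p. 72] -/
theorem exists_isHaarMeasure_family_cmLocalIntegralLevel_eq_one
    [∀ v : HeightOneSpectrum (𝓞 ↥(maximalRealSubfield L)), MeasurableSpace ((cmDatum L N H).Local v)]
    [∀ v : HeightOneSpectrum (𝓞 ↥(maximalRealSubfield L)), BorelSpace ((cmDatum L N H).Local v)] :
    ∃ ν : ∀ v : HeightOneSpectrum (𝓞 ↥(maximalRealSubfield L)), Measure ((cmDatum L N H).Local v),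
      (∀ v, IsHaarMeasure (ν v)) ∧ ∀ v, ν v (cmLocalIntegralLevel L N H v) = 1 := by
  choose ν hν h1 using fun v => exists_isHaarMeasure_cmLocalIntegralLevel_eq_one L N H v
  exact ⟨ν, hν, h1⟩

variable {L N H}

/-- A Haar measure on `U(H)(L⁺_v)` read on the model factor `localPi … v` through a local model isomorphism `ψ` (★ `localPiEquiv`) is a Haar measure
(`ψ` is bound as DATA with its equation available to the caller — the carrier `(cmDatum L N H).Local v` is kept syntactic, as in ★
`UnitaryGroup.finAdelicOrbitalMeasureOfLocal_quotientMeasure_eq`). [cite: BorelJacquet1979, §4.1] -/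
theorem isHaarMeasure_map_localModel_symm (v : HeightOneSpectrum (𝓞 ↥(maximalRealSubfield L)))
    [MeasurableSpace ((cmDatum L N H).Local v)] [BorelSpace ((cmDatum L N H).Local v)]
    [MeasurableSpace ↥(localPi L (IsCMField.complexConj L) N H v)] [BorelSpace ↥(localPi L (IsCMField.complexConj L) N H v)]
    (ψ : ↥(localPi L (IsCMField.complexConj L) N H v) ≃ₜ* (cmDatum L N H).Local v)
    (ν : Measure ((cmDatum L N H).Local v)) [IsHaarMeasure ν] :
    IsHaarMeasure (Measure.map ψ.symm ν) :=
  ψ.symm.isHaarMeasure_map ν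

/-- … and, for `ψ = localPiEquiv … v`, still gives mass `ν_v(U(H)(𝒪_v))` to the integral level `localInt … v` (★ `localPiEquiv_symm_mem_localInt_iff`).
[cite: PlatonovRapinchuk1994, §5.1] -/
theorem map_localPiEquiv_symm_apply_localInt (v : HeightOneSpectrum (𝓞 ↥(maximalRealSubfield L)))
    [MeasurableSpace ((cmDatum L N H).Local v)] [BorelSpace ((cmDatum L N H).Local v)]
    [MeasurableSpace ↥(localPi L (IsCMField.complexConj L) N H v)] [BorelSpace ↥(localPi L (IsCMField.complexConj L) N H v)]
    (ψ : ↥(localPi L (IsCMField.complexConj L) N H v) ≃ₜ* (cmDatum L N H).Local v)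
    (hψ : ψ = localPiEquiv L (IsCMField.complexConj L) N H v) (ν : Measure ((cmDatum L N H).Local v)) :
    Measure.map ψ.symm ν (localInt L (IsCMField.complexConj L) N H v : Set ↥(localPi L (IsCMField.complexConj L) N H v)) =
      ν (cmLocalIntegralLevel L N H v) := by
  rw [Measure.map_apply (map_continuous ψ.symm).measurable (isOpen_localInt L (IsCMField.complexConj L) N H v).measurableSet]
  congr 1
  subst hψ
  exact Set.ext fun x => localPiEquiv_symm_mem_localInt_iff (IsCMField.complexConj L) N H v x

/-- Hence a NORMALISED family stays normalised on the model factors: `((localPiEquiv v)⁻¹_* ν_v)(localInt v) = 1`. [cite: Rogawski1990, §5.4 p. 72] -/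
theorem map_localPiEquiv_symm_apply_localInt_eq_one (v : HeightOneSpectrum (𝓞 ↥(maximalRealSubfield L)))
    [MeasurableSpace ((cmDatum L N H).Local v)] [BorelSpace ((cmDatum L N H).Local v)]
    [MeasurableSpace ↥(localPi L (IsCMField.complexConj L) N H v)] [BorelSpace ↥(localPi L (IsCMField.complexConj L) N H v)]
    (ψ : ↥(localPi L (IsCMField.complexConj L) N H v) ≃ₜ* (cmDatum L N H).Local v)
    (hψ : ψ = localPiEquiv L (IsCMField.complexConj L) N H v) (ν : Measure ((cmDatum L N H).Local v))
    (hν : ν (cmLocalIntegralLevel L N H v) = 1) :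
    Measure.map ψ.symm ν (localInt L (IsCMField.complexConj L) N H v : Set ↥(localPi L (IsCMField.complexConj L) N H v)) = 1 := by
  rw [map_localPiEquiv_symm_apply_localInt v ψ hψ, hν]

/-- **THE NORMALISED FAMILY ON THE MODEL FACTORS**: Haar measures `ν'_v` on the `localPi … v` with `ν'_v(localInt … v) = 1` for EVERY finite `v`
(§1 transported through ★ `localPiEquiv`) — the `(ν', hν1)` input of §2∕§3 with `S₀ = ∅`. [cite: PlatonovRapinchuk1994, §3.5] [cite: Rogawski1990, §5.4 p. 72] -/
theorem exists_isHaarMeasure_family_localInt_eq_one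
    [∀ v : HeightOneSpectrum (𝓞 ↥(maximalRealSubfield L)), MeasurableSpace ↥(localPi L (IsCMField.complexConj L) N H v)]
    [∀ v : HeightOneSpectrum (𝓞 ↥(maximalRealSubfield L)), BorelSpace ↥(localPi L (IsCMField.complexConj L) N H v)] :
    ∃ ν' : ∀ v : HeightOneSpectrum (𝓞 ↥(maximalRealSubfield L)), Measure ↥(localPi L (IsCMField.complexConj L) N H v),
      (∀ v, IsHaarMeasure (ν' v)) ∧
        ∀ v, ν' v (localInt L (IsCMField.complexConj L) N H v : Set ↥(localPi L (IsCMField.complexConj L) N H v)) = 1 := by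
  haveI : ∀ v, LocallyCompactSpace ↥(localPi L (IsCMField.complexConj L) N H v) :=
    fun v => locallyCompactSpace_localPi L N (IsCMField.complexConj L) H v
  have h : ∀ v : HeightOneSpectrum (𝓞 ↥(maximalRealSubfield L)), ∃ μ : Measure ↥(localPi L (IsCMField.complexConj L) N H v),
      IsHaarMeasure μ ∧ μ (localInt L (IsCMField.complexConj L) N H v : Set ↥(localPi L (IsCMField.complexConj L) N H v)) = 1 :=
    fun v => exists_isHaarMeasure_apply_eq_one (isCompact_localInt L (IsCMField.complexConj L) N H v)
      (by rw [(isOpen_localInt L (IsCMField.complexConj L) N H v).interior_eq]; exact ⟨1, (localInt L (IsCMField.complexConj L) N H v).one_mem⟩)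
  choose ν' hν' h1 using h
  exact ⟨ν', hν', h1⟩

end Local

/-! ## §2 The restricted product of the normalised local Haar measures is a Haar measure on `U(H)(𝔸_{L⁺,f})` -/

section Fin

variable {L N H}
variable [∀ v : HeightOneSpectrum (𝓞 ↥(maximalRealSubfield L)), MeasurableSpace ↥(localPi L (IsCMField.complexConj L) N H v)]
  [∀ v : HeightOneSpectrum (𝓞 ↥(maximalRealSubfield L)), BorelSpace ↥(localPi L (IsCMField.complexConj L) N H v)]
  (ν' : ∀ v : HeightOneSpectrum (𝓞 ↥(maximalRealSubfield L)), Measure ↥(localPi L (IsCMField.complexConj L) N H v))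
  [∀ v, IsHaarMeasure (ν' v)] (S₀ : Finset (HeightOneSpectrum (𝓞 ↥(maximalRealSubfield L))))

/-- **`∏'_v (ν_v ; U(H)(𝒪_v))` IS a Haar measure** on `∏'_v (U(H)(L⁺_v) : U(H)(𝒪_v))`, for local Haar measures with `ν_v(U(H)(𝒪_v)) = 1` off `S₀`
(★ `isHaarMeasure_rpMeasure`; the factors are second countable locally compact groups, the `U(H)(𝒪_v)` compact open).
[cite: CasselsFrohlichANT1967, Ch. XV (Tate) §3.3] [cite: BorelJacquet1979, §4.1] -/
theorem isHaarMeasure_rpMeasure_localInt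
    (hν1 : ∀ v, v ∉ S₀ → ν' v (localInt L (IsCMField.complexConj L) N H v : Set ↥(localPi L (IsCMField.complexConj L) N H v)) = 1) :
    IsHaarMeasure (rpMeasure (fun v => (localInt L (IsCMField.complexConj L) N H v : Set ↥(localPi L (IsCMField.complexConj L) N H v))) ν' S₀) := by
  haveI : ∀ v, SecondCountableTopology ↥(localPi L (IsCMField.complexConj L) N H v) :=
    fun v => secondCountableTopology_localPi L N (IsCMField.complexConj L) H v
  haveI : ∀ v, LocallyCompactSpace ↥(localPi L (IsCMField.complexConj L) N H v) :=
    fun v => locallyCompactSpace_localPi L N (IsCMField.complexConj L) H v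
  haveI : Countable (HeightOneSpectrum (𝓞 ↥(maximalRealSubfield L))) := countable_heightOneSpectrum ↥(maximalRealSubfield L)
  let C : ∀ v, TopologicalSpace.PositiveCompacts ↥(localPi L (IsCMField.complexConj L) N H v) := fun v =>
    { carrier := (localInt L (IsCMField.complexConj L) N H v : Set _)
      isCompact' := isCompact_localInt L (IsCMField.complexConj L) N H v
      interior_nonempty' := by
        rw [(isOpen_localInt L (IsCMField.complexConj L) N H v).interior_eq]
        exact ⟨1, (localInt L (IsCMField.complexConj L) N H v).one_mem⟩ }
  exact isHaarMeasure_rpMeasure (fun v => localInt L (IsCMField.complexConj L) N H v) S₀ C ν'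
    (fun v _ => isCompact_localInt L (IsCMField.complexConj L) N H v) hν1

/-- The restricted product measure gives the integral box `{x | ∀ v, x_v ∈ U(H)(𝒪_v)}` the mass `∏_{v ∈ S₀} ν_v(U(H)(𝒪_v))` (★ `rpMeasure_haarBox`).
[cite: CasselsFrohlichANT1967, Ch. XV (Tate) §3.3] -/
theorem rpMeasure_localInt_apply_box
    (hν1 : ∀ v, v ∉ S₀ → ν' v (localInt L (IsCMField.complexConj L) N H v : Set ↥(localPi L (IsCMField.complexConj L) N H v)) = 1) :
    rpMeasure (fun v => (localInt L (IsCMField.complexConj L) N H v : Set ↥(localPi L (IsCMField.complexConj L) N H v))) ν' S₀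
        {x | ∀ v, x v ∈ (localInt L (IsCMField.complexConj L) N H v : Set ↥(localPi L (IsCMField.complexConj L) N H v))} =
      ∏ v ∈ S₀, ν' v (localInt L (IsCMField.complexConj L) N H v : Set ↥(localPi L (IsCMField.complexConj L) N H v)) := by
  haveI : ∀ v, SecondCountableTopology ↥(localPi L (IsCMField.complexConj L) N H v) :=
    fun v => secondCountableTopology_localPi L N (IsCMField.complexConj L) H v
  haveI : ∀ v, LocallyCompactSpace ↥(localPi L (IsCMField.complexConj L) N H v) :=
    fun v => locallyCompactSpace_localPi L N (IsCMField.complexConj L) H v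
  haveI : Countable (HeightOneSpectrum (𝓞 ↥(maximalRealSubfield L))) := countable_heightOneSpectrum ↥(maximalRealSubfield L)
  let C : ∀ v, TopologicalSpace.PositiveCompacts ↥(localPi L (IsCMField.complexConj L) N H v) := fun v =>
    { carrier := (localInt L (IsCMField.complexConj L) N H v : Set _)
      isCompact' := isCompact_localInt L (IsCMField.complexConj L) N H v
      interior_nonempty' := by
        rw [(isOpen_localInt L (IsCMField.complexConj L) N H v).interior_eq]
        exact ⟨1, (localInt L (IsCMField.complexConj L) N H v).one_mem⟩ }
  have hbox : {x : Πʳ v : HeightOneSpectrum (𝓞 ↥(maximalRealSubfield L)),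
        [↥(localPi L (IsCMField.complexConj L) N H v), localInt L (IsCMField.complexConj L) N H v] |
        ∀ v, x v ∈ (localInt L (IsCMField.complexConj L) N H v : Set ↥(localPi L (IsCMField.complexConj L) N H v))} =
      haarBox (fun v => localInt L (IsCMField.complexConj L) N H v) S₀ C := by
    ext x
    exact ⟨fun h => ⟨fun v _ => h v, fun v _ => h v⟩, fun h v => by
      by_cases hv : v ∈ S₀
      · exact h.1 v hv
      · exact h.2 v hv⟩
  rw [hbox, rpMeasure_haarBox (fun v => localInt L (IsCMField.complexConj L) N H v) S₀ C ν' hν1]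
  exact Finset.prod_coe_sort S₀ fun v =>
    ν' v (localInt L (IsCMField.complexConj L) N H v : Set ↥(localPi L (IsCMField.complexConj L) N H v))

end Fin

/-! ### Transport to `U(H)(𝔸_{L⁺,f})` along ★ `finAdelicEquiv`, and Haar uniqueness there -/

section FinAdelic

variable {L N H}
variable [∀ v : HeightOneSpectrum (𝓞 ↥(maximalRealSubfield L)), MeasurableSpace ↥(localPi L (IsCMField.complexConj L) N H v)]
  [∀ v : HeightOneSpectrum (𝓞 ↥(maximalRealSubfield L)), BorelSpace ↥(localPi L (IsCMField.complexConj L) N H v)]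
  [MeasurableSpace (finAdelic (↥(maximalRealSubfield L)) L (IsCMField.complexConj L) N H)]
  [BorelSpace (finAdelic (↥(maximalRealSubfield L)) L (IsCMField.complexConj L) N H)]

/-- A Haar measure on the restricted-product model, transported to `U(H)(𝔸_{L⁺,f})` along ★ `finAdelicEquiv⁻¹`, is a Haar measure (spelled with
`(finAdelicEquiv …).symm.toMulEquiv`, the `hνf` expression of ★ `UnitaryGroup.finAdelicOrbitalMeasureOfLocal_quotientMeasure_eq`).
[cite: BorelJacquet1979, §4.1] [cite: PlatonovRapinchuk1994, §5.1] -/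
theorem isHaarMeasure_map_finAdelicEquiv_symm
    (νrp : Measure (Πʳ v : HeightOneSpectrum (𝓞 ↥(maximalRealSubfield L)),
      [↥(localPi L (IsCMField.complexConj L) N H v), localInt L (IsCMField.complexConj L) N H v])) [IsHaarMeasure νrp] :
    IsHaarMeasure (Measure.map (finAdelicEquiv (↥(maximalRealSubfield L)) L (IsCMField.complexConj L) N H).symm.toMulEquiv νrp) := by
  haveI : ∀ v, SecondCountableTopology ↥(localPi L (IsCMField.complexConj L) N H v) :=
    fun v => secondCountableTopology_localPi L N (IsCMField.complexConj L) H v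
  haveI : Countable (HeightOneSpectrum (𝓞 ↥(maximalRealSubfield L))) := countable_heightOneSpectrum ↥(maximalRealSubfield L)
  haveI : BorelSpace (Πʳ v : HeightOneSpectrum (𝓞 ↥(maximalRealSubfield L)),
      [↥(localPi L (IsCMField.complexConj L) N H v), localInt L (IsCMField.complexConj L) N H v]) :=
    borelSpace (fun v => (localInt L (IsCMField.complexConj L) N H v : Set ↥(localPi L (IsCMField.complexConj L) N H v)))
      fun v => (isOpen_localInt L (IsCMField.complexConj L) N H v).measurableSet
  exact (finAdelicEquiv (↥(maximalRealSubfield L)) L (IsCMField.complexConj L) N H).symm.isHaarMeasure_map νrp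

/-- **`ν_f(K_f⁰) = ν_rp{x | ∀ v, x_v ∈ U(H)(𝒪_v)}`**: the transported measure of the integral level ★ `finAdelicIntegralLevel = ∏_v U(H)(𝒪_v)`
(★ `mem_finAdelicIntegralLevel_iff_forall`). [cite: PlatonovRapinchuk1994, §5.1] -/
theorem map_finAdelicEquiv_symm_apply_finAdelicIntegralLevel
    (νrp : Measure (Πʳ v : HeightOneSpectrum (𝓞 ↥(maximalRealSubfield L)),
      [↥(localPi L (IsCMField.complexConj L) N H v), localInt L (IsCMField.complexConj L) N H v])) :
    Measure.map (finAdelicEquiv (↥(maximalRealSubfield L)) L (IsCMField.complexConj L) N H).symm.toMulEquiv νrp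
        (finAdelicIntegralLevel (↥(maximalRealSubfield L)) L (IsCMField.complexConj L) N H :
          Set (finAdelic (↥(maximalRealSubfield L)) L (IsCMField.complexConj L) N H)) =
      νrp {x | ∀ v, x v ∈ (localInt L (IsCMField.complexConj L) N H v : Set ↥(localPi L (IsCMField.complexConj L) N H v))} := by
  haveI : ∀ v, SecondCountableTopology ↥(localPi L (IsCMField.complexConj L) N H v) :=
    fun v => secondCountableTopology_localPi L N (IsCMField.complexConj L) H v
  haveI : Countable (HeightOneSpectrum (𝓞 ↥(maximalRealSubfield L))) := countable_heightOneSpectrum ↥(maximalRealSubfield L)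
  haveI : BorelSpace (Πʳ v : HeightOneSpectrum (𝓞 ↥(maximalRealSubfield L)),
      [↥(localPi L (IsCMField.complexConj L) N H v), localInt L (IsCMField.complexConj L) N H v]) :=
    borelSpace (fun v => (localInt L (IsCMField.complexConj L) N H v : Set ↥(localPi L (IsCMField.complexConj L) N H v)))
      fun v => (isOpen_localInt L (IsCMField.complexConj L) N H v).measurableSet
  have hmeas : Measurable ⇑(finAdelicEquiv (↥(maximalRealSubfield L)) L (IsCMField.complexConj L) N H).symm.toMulEquiv :=
    (finAdelicEquiv (↥(maximalRealSubfield L)) L (IsCMField.complexConj L) N H).symm.continuous.measurable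
  rw [Measure.map_apply hmeas (isOpen_finAdelicIntegralLevel (↥(maximalRealSubfield L)) L (IsCMField.complexConj L) N H).measurableSet]
  congr 1
  ext x
  simp only [Set.mem_preimage, SetLike.mem_coe, Set.mem_setOf_eq, mem_finAdelicIntegralLevel_iff_forall]
  refine forall_congr' fun v => ?_
  rw [show (finAdelicEquiv (↥(maximalRealSubfield L)) L (IsCMField.complexConj L) N H)
      ((finAdelicEquiv (↥(maximalRealSubfield L)) L (IsCMField.complexConj L) N H).symm.toMulEquiv x) = x from
    (finAdelicEquiv (↥(maximalRealSubfield L)) L (IsCMField.complexConj L) N H).apply_symm_apply x]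

variable (ν' : ∀ v : HeightOneSpectrum (𝓞 ↥(maximalRealSubfield L)), Measure ↥(localPi L (IsCMField.complexConj L) N H v))
  [∀ v, IsHaarMeasure (ν' v)] (S₀ : Finset (HeightOneSpectrum (𝓞 ↥(maximalRealSubfield L))))

/-- **The restricted product of the local Haar measures, read on `U(H)(𝔸_{L⁺,f})`, is a Haar measure `ν_f`** (§2 + transport).
[cite: CasselsFrohlichANT1967, Ch. XV (Tate) §3.3] [cite: BorelJacquet1979, §4.1] -/
theorem isHaarMeasure_map_finAdelicEquiv_symm_rpMeasure
    (hν1 : ∀ v, v ∉ S₀ → ν' v (localInt L (IsCMField.complexConj L) N H v : Set ↥(localPi L (IsCMField.complexConj L) N H v)) = 1) :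
    IsHaarMeasure (Measure.map (finAdelicEquiv (↥(maximalRealSubfield L)) L (IsCMField.complexConj L) N H).symm.toMulEquiv
      (rpMeasure (fun v => (localInt L (IsCMField.complexConj L) N H v : Set ↥(localPi L (IsCMField.complexConj L) N H v))) ν' S₀)) := by
  haveI := isHaarMeasure_rpMeasure_localInt ν' S₀ hν1
  exact isHaarMeasure_map_finAdelicEquiv_symm _

/-- **`ν_f(K_f⁰) = ∏_{v ∈ S₀} ν_v(U(H)(𝒪_v))`** for `ν_f = (finAdelicEquiv⁻¹)_* ∏'_v (ν_v ; U(H)(𝒪_v))`. [cite: CasselsFrohlichANT1967, Ch. XV (Tate) §3.3] -/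
theorem map_finAdelicEquiv_symm_rpMeasure_apply_finAdelicIntegralLevel
    (hν1 : ∀ v, v ∉ S₀ → ν' v (localInt L (IsCMField.complexConj L) N H v : Set ↥(localPi L (IsCMField.complexConj L) N H v)) = 1) :
    Measure.map (finAdelicEquiv (↥(maximalRealSubfield L)) L (IsCMField.complexConj L) N H).symm.toMulEquiv
        (rpMeasure (fun v => (localInt L (IsCMField.complexConj L) N H v : Set ↥(localPi L (IsCMField.complexConj L) N H v))) ν' S₀)
        (finAdelicIntegralLevel (↥(maximalRealSubfield L)) L (IsCMField.complexConj L) N H :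
          Set (finAdelic (↥(maximalRealSubfield L)) L (IsCMField.complexConj L) N H)) =
      ∏ v ∈ S₀, ν' v (localInt L (IsCMField.complexConj L) N H v : Set ↥(localPi L (IsCMField.complexConj L) N H v)) := by
  rw [map_finAdelicEquiv_symm_apply_finAdelicIntegralLevel, rpMeasure_localInt_apply_box ν' S₀ hν1]

/-- … so for the FULLY normalised family (`S₀ = ∅`): **`ν_f(K_f⁰) = 1`** — `ν_f` is THE Haar measure on `U(H)(𝔸_{L⁺,f})` normalised by the integral
level `K_f⁰ = ∏_v U(H)(𝒪_v)`. [cite: Rogawski1990, §5.4 p. 72] [cite: CasselsFrohlichANT1967, Ch. XV (Tate) §3.3] -/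
theorem map_finAdelicEquiv_symm_rpMeasure_apply_finAdelicIntegralLevel_eq_one
    (hν1 : ∀ v, ν' v (localInt L (IsCMField.complexConj L) N H v : Set ↥(localPi L (IsCMField.complexConj L) N H v)) = 1) :
    Measure.map (finAdelicEquiv (↥(maximalRealSubfield L)) L (IsCMField.complexConj L) N H).symm.toMulEquiv
        (rpMeasure (fun v => (localInt L (IsCMField.complexConj L) N H v : Set ↥(localPi L (IsCMField.complexConj L) N H v))) ν' ∅)
        (finAdelicIntegralLevel (↥(maximalRealSubfield L)) L (IsCMField.complexConj L) N H :
          Set (finAdelic (↥(maximalRealSubfield L)) L (IsCMField.complexConj L) N H)) = 1 := by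
  rw [map_finAdelicEquiv_symm_rpMeasure_apply_finAdelicIntegralLevel ν' ∅ (fun v _ => hν1 v), Finset.prod_empty]

/-- **Haar uniqueness on `U(H)(𝔸_{L⁺,f})`: every Haar measure is `κ • ν_f`**, `0 < κ < ∞`, for the transported restricted product `ν_f` of any
local Haar family normalised off `S₀` (the identification used inline by ★ `exists_integral_finFactor_eq_mul_prod`; `κ = μ_f(K_f⁰) ∕ ∏_{v∈S₀} ν_v(U(H)(𝒪_v))`).
[cite: CasselsFrohlichANT1967, Ch. XV (Tate) §3.3] [cite: BorelJacquet1979, §4.1] -/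
theorem exists_eq_smul_map_finAdelicEquiv_symm_rpMeasure
    (hν1 : ∀ v, v ∉ S₀ → ν' v (localInt L (IsCMField.complexConj L) N H v : Set ↥(localPi L (IsCMField.complexConj L) N H v)) = 1)
    (μf : Measure (finAdelic (↥(maximalRealSubfield L)) L (IsCMField.complexConj L) N H)) [IsHaarMeasure μf] :
    ∃ κ : ℝ≥0∞, κ ≠ 0 ∧ κ ≠ ∞ ∧
      μf = κ • Measure.map (finAdelicEquiv (↥(maximalRealSubfield L)) L (IsCMField.complexConj L) N H).symm.toMulEquiv
        (rpMeasure (fun v => (localInt L (IsCMField.complexConj L) N H v : Set ↥(localPi L (IsCMField.complexConj L) N H v))) ν' S₀) := by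
  haveI := locallyCompactSpace_finAdelic (↥(maximalRealSubfield L)) L (IsCMField.complexConj L) N H
  haveI := secondCountableTopology_finAdelic (↥(maximalRealSubfield L)) L (IsCMField.complexConj L) N H
  haveI : SigmaCompactSpace (finAdelic (↥(maximalRealSubfield L)) L (IsCMField.complexConj L) N H) :=
    sigmaCompactSpace_of_locallyCompact_secondCountable
  haveI := isHaarMeasure_map_finAdelicEquiv_symm_rpMeasure ν' S₀ hν1
  -- the reference positive compact set `K_f⁰`
  let K₀ : TopologicalSpace.PositiveCompacts (finAdelic (↥(maximalRealSubfield L)) L (IsCMField.complexConj L) N H) :=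
    { carrier := (finAdelicIntegralLevel (↥(maximalRealSubfield L)) L (IsCMField.complexConj L) N H : Set _)
      isCompact' := isCompact_finAdelicIntegralLevel (↥(maximalRealSubfield L)) L (IsCMField.complexConj L) N H
      interior_nonempty' := by
        rw [(isOpen_finAdelicIntegralLevel (↥(maximalRealSubfield L)) L (IsCMField.complexConj L) N H).interior_eq]
        exact ⟨1, (finAdelicIntegralLevel (↥(maximalRealSubfield L)) L (IsCMField.complexConj L) N H).one_mem⟩ }
  set νf := Measure.map (finAdelicEquiv (↥(maximalRealSubfield L)) L (IsCMField.complexConj L) N H).symm.toMulEquiv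
    (rpMeasure (fun v => (localInt L (IsCMField.complexConj L) N H v : Set ↥(localPi L (IsCMField.complexConj L) N H v))) ν' S₀) with hνf
  -- `ν_f(K_f⁰) = ∏_{v∈S₀} ν_v(U(H)(𝒪_v)) ∈ (0, ∞)`
  have hp : νf (K₀ : Set _) = ∏ v ∈ S₀, ν' v (localInt L (IsCMField.complexConj L) N H v : Set ↥(localPi L (IsCMField.complexConj L) N H v)) :=
    map_finAdelicEquiv_symm_rpMeasure_apply_finAdelicIntegralLevel ν' S₀ hν1
  have hp0 : νf (K₀ : Set _) ≠ 0 := by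
    rw [hp]
    exact Finset.prod_ne_zero_iff.2 fun v _ => ((isOpen_localInt L (IsCMField.complexConj L) N H v).measure_pos (ν' v)
      ⟨1, (localInt L (IsCMField.complexConj L) N H v).one_mem⟩).ne'
  have hptop : νf (K₀ : Set _) ≠ ∞ := by
    rw [hp]
    exact ENNReal.prod_ne_top fun v _ => (isCompact_localInt L (IsCMField.complexConj L) N H v).measure_lt_top.ne
  have h1 := Measure.haarMeasure_unique μf K₀
  have h2 := Measure.haarMeasure_unique νf K₀
  have h3 : Measure.haarMeasure K₀ = (νf (K₀ : Set _))⁻¹ • νf := by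
    have h4 : (νf (K₀ : Set _))⁻¹ • νf = (νf (K₀ : Set _))⁻¹ • (νf (K₀ : Set _) • Measure.haarMeasure K₀) := by
      rw [← h2]
    rw [h4, smul_smul, ENNReal.inv_mul_cancel hp0 hptop, one_smul]
  refine ⟨μf (K₀ : Set _) * (νf (K₀ : Set _))⁻¹, mul_ne_zero ?_ (ENNReal.inv_ne_zero.2 hptop),
    ENNReal.mul_ne_top K₀.isCompact.measure_lt_top.ne (ENNReal.inv_ne_top.2 hp0), ?_⟩
  · exact (Measure.measure_pos_of_nonempty_interior μf K₀.interior_nonempty).ne'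
  · rw [← smul_smul, ← h3]
    exact h1

end FinAdelic

/-! ## §3 Every Haar measure on `U(H)(𝔸_{L⁺})` is `dh_∞ ⊗ dh_f` with the Weil constant absorbed at infinity -/

section Adelic

variable {L N H}
variable [MeasurableSpace (cmDatum L N H).Adelic] [BorelSpace (cmDatum L N H).Adelic]
  [MeasurableSpace (arch (↥(maximalRealSubfield L)) L (IsCMField.complexConj L) N H)]
  [BorelSpace (arch (↥(maximalRealSubfield L)) L (IsCMField.complexConj L) N H)]
  [MeasurableSpace (finAdelic (↥(maximalRealSubfield L)) L (IsCMField.complexConj L) N H)]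
  [BorelSpace (finAdelic (↥(maximalRealSubfield L)) L (IsCMField.complexConj L) N H)]

/-- **(C-glob) Every Haar measure `ν_𝔸` on `U(H)(𝔸_{L⁺})` is `(adelicProdEquiv⁻¹)_* (ν_∞ ⊗ ν_f)` ON THE NOSE** for a suitable Haar measure `ν_∞` on
`U(H)(L⁺ ⊗ ℝ)`, GIVEN any Haar measure `ν_f` on `U(H)(𝔸_{L⁺,f})`: the constant `κ > 0` of ★ `exists_map_adelicProdEquiv_eq_smul_prod` is absorbed into
`ν_∞ := κ • dh_∞`.  The model isomorphism is bound as DATA `e` with its equation `he'` (the `(e, he', hνA)` binders of ★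
`UnitaryGroup.adelicOrbitalMeasureOfLocal_quotientMeasure_eq`), so the conclusion IS that `hνA`. [cite: BorelJacquet1979, §4.1] [cite: Rogawski1990, §4.3 p. 44] -/
theorem exists_isHaarMeasure_arch_eq_map_prod
    (νA : Measure (cmDatum L N H).Adelic) [IsHaarMeasure νA]
    (νf : Measure (finAdelic (↥(maximalRealSubfield L)) L (IsCMField.complexConj L) N H)) [IsHaarMeasure νf]
    (e : arch (↥(maximalRealSubfield L)) L (IsCMField.complexConj L) N H × finAdelic (↥(maximalRealSubfield L)) L (IsCMField.complexConj L) N H ≃*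
      (cmDatum L N H).Adelic)
    (he' : e = (adelicProdEquiv (↥(maximalRealSubfield L)) L (IsCMField.complexConj L) N H).symm.toMulEquiv) :
    ∃ νi : Measure (arch (↥(maximalRealSubfield L)) L (IsCMField.complexConj L) N H), IsHaarMeasure νi ∧ νA = Measure.map e (νi.prod νf) := by
  subst he'
  haveI := locallyCompactSpace_finAdelic (↥(maximalRealSubfield L)) L (IsCMField.complexConj L) N H
  haveI := secondCountableTopology_finAdelic (↥(maximalRealSubfield L)) L (IsCMField.complexConj L) N H
  -- `adelicProdEquiv` re-read on the datum carrier `(cmDatum L N H).Adelic` (= `↥(adelic L⁺ L c N H)` by `rfl`, not unfolded by instance search)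
  let E : (cmDatum L N H).Adelic ≃ₜ*
      arch (↥(maximalRealSubfield L)) L (IsCMField.complexConj L) N H × finAdelic (↥(maximalRealSubfield L)) L (IsCMField.complexConj L) N H :=
    { adelicProdEquiv (↥(maximalRealSubfield L)) L (IsCMField.complexConj L) N H with }
  obtain ⟨κ, hκ, hmap⟩ :=
    Literature.MeasureTheory.Group.exists_map_continuousMulEquiv_eq_smul_prod E νA Measure.haar νf
  refine ⟨κ • Measure.haar, IsHaarMeasure.nnreal_smul Measure.haar hκ.ne', ?_⟩
  rw [Measure.prod_smul_left, ← hmap]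
  exact (MeasurableEquiv.map_symm_map E.toHomeomorph.toMeasurableEquiv (μ := νA)).symm

variable [∀ v : HeightOneSpectrum (𝓞 ↥(maximalRealSubfield L)), MeasurableSpace ↥(localPi L (IsCMField.complexConj L) N H v)]
  [∀ v : HeightOneSpectrum (𝓞 ↥(maximalRealSubfield L)), BorelSpace ↥(localPi L (IsCMField.complexConj L) N H v)]
  (ν' : ∀ v : HeightOneSpectrum (𝓞 ↥(maximalRealSubfield L)), Measure ↥(localPi L (IsCMField.complexConj L) N H v))
  [∀ v, IsHaarMeasure (ν' v)] (S₀ : Finset (HeightOneSpectrum (𝓞 ↥(maximalRealSubfield L))))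

/-- **(C-glob) with THE restricted product of the normalised local Haar measures**: for every Haar measure `ν_𝔸` on `U(H)(𝔸_{L⁺})` and every local
Haar family `(ν_v)` with `ν_v(U(H)(𝒪_v)) = 1` off `S₀` there is a Haar measure `ν_∞` on `U(H)(L⁺ ⊗ ℝ)` with
`ν_𝔸 = (adelicProdEquiv⁻¹)_* (ν_∞ ⊗ (finAdelicEquiv⁻¹)_* ∏'_v (ν_v ; U(H)(𝒪_v)))` — the `hνrp`∕`hνf`∕`hνA` expressions of ★
`UnitaryGroup.adelicOrbitalMeasureOfLocal_quotientMeasure_eq` at once, for an ARBITRARY Haar measure of the kit ([Rogawski1990, §5.4 p. 72]: `dg = ⊗_v dg_v`,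
`vol(K_v) = 1` for almost all `v`). [cite: Rogawski1990, §5.4 p. 72] [cite: CasselsFrohlichANT1967, Ch. XV (Tate) §3.3] -/
theorem exists_isHaarMeasure_arch_eq_map_prod_rpMeasure
    (hν1 : ∀ v, v ∉ S₀ → ν' v (localInt L (IsCMField.complexConj L) N H v : Set ↥(localPi L (IsCMField.complexConj L) N H v)) = 1)
    (νA : Measure (cmDatum L N H).Adelic) [IsHaarMeasure νA]
    (e : arch (↥(maximalRealSubfield L)) L (IsCMField.complexConj L) N H × finAdelic (↥(maximalRealSubfield L)) L (IsCMField.complexConj L) N H ≃*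
      (cmDatum L N H).Adelic)
    (he' : e = (adelicProdEquiv (↥(maximalRealSubfield L)) L (IsCMField.complexConj L) N H).symm.toMulEquiv) :
    ∃ νi : Measure (arch (↥(maximalRealSubfield L)) L (IsCMField.complexConj L) N H), IsHaarMeasure νi ∧
      νA = Measure.map e (νi.prod (Measure.map (finAdelicEquiv (↥(maximalRealSubfield L)) L (IsCMField.complexConj L) N H).symm.toMulEquiv
        (rpMeasure (fun v => (localInt L (IsCMField.complexConj L) N H v : Set ↥(localPi L (IsCMField.complexConj L) N H v))) ν' S₀))) := by
  haveI := isHaarMeasure_map_finAdelicEquiv_symm_rpMeasure ν' S₀ hν1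
  exact exists_isHaarMeasure_arch_eq_map_prod νA _ e he'

end Adelic

end UnitaryGroup

end Literature.NumberTheory.Automorphic
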